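import Summits.BirchSwinnertonDyer.BirchSwinnertonDyer.Theorems.ErratumRoadFiveTateTorsionRigidityOpenImage
import Literature.NumberTheory.EllipticCurves.IsogenyGroundFieldExtension
import Literature.NumberTheory.GaloisRepresentations.AbsGaloisRestrictSurjective
import HarnessLib

/-!
# Route `ErratumRoadFive` (K2, `p ≥ 5`), crux (T) `Rest3TorsionBranchAtFive` (item
# stmt-BirchSwinnertonDyer-19702): (L1) TRANSPORTED TO ANY `ℚ_p`-MODEL — for a field `F` with a
# bijective structure map `ℚ_p → F` (the completion `K_𝔭` at a DEGREE-ONE prime `𝔭 ∣ p`,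
# `K_𝔭 = ℚ_p`), `Γ_F → Γ_{ℚ_p}` is a topological isomorphism, `E(ℚ̄_p) ≃ E(F̄)` equivariantly, and
# «a Tate curve acquires no new `p`-power torsion in the fixed field of an open-image character»
# holds for `Γ_F` acting on `E(F̄)` — half of object (O2′) of THEOREM T♭ (memo PROOF-BDP §33.12)

Cell `bsd-stepL` (run/shared/lean/pub/bsd-stepL/), seat `bsd-stepL-bdp` (prover g16, 2026-08-27), memo
`HOME/proof/PROOF-BDP.md` §31.2 (E), §33.9–§33.13; `--supports stmt-BirchSwinnertonDyer-19702 --as helper`.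

WHY. g15 reduced the E-side local input of THEOREM T♭ (erratum Thm. 1.1 WITHOUT (iv)) to the
`ker`-fixed `p`-power torsion of `E(K̄)` under the decomposition group `Γ_{K_𝔭} → Γ_K`
(`BigGaloisRep.localMap K (Sum.inl 𝔭) = absGaloisRestrict K K_𝔭`), while (L1) is a theorem about
`Γ_{ℚ_p}` acting on `E(ℚ̄_p)` (`TateTorsionRigidity.openImage_curve_exists_generator_fixed_torsion`,
p486449). The bridge (O2′) is pure field theory: at a degree-one prime the structure map `ℚ_p → K_𝔭` is
a BIJECTION (tree `adicCompletionEquivOfDegreeOne` ∘ Mathlib `Padic.adicCompletionEquiv`), and for ANY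
`ℚ_p`-field `F` with bijective structure map:

* §1 `bijective_absClosureEmbedding` ∕ `bijective_absGaloisRestrict` — the chosen embedding
  `ℚ̄_p → F̄` (`absClosureEmbedding`) is an isomorphism and the restriction `Γ_F → Γ_{ℚ_p}`
  (`absGaloisRestrict`) is a bijection (tree `absGaloisRestrict_injective`,
  `absGaloisRestrict_surjective_of_isIntegrallyClosedIn`); `exists_continuousMonoidHom_comp_absGaloisRestrict`
  — every continuous character of `Γ_F` factors through it CONTINUOUSLY (compact → Hausdorff);
* §2 `geomPointsExtend_absGaloisRestrict_smul` — the tree's transport of points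
  `geomPointsExtend : E(k̄) ≃+ E_F(F̄)` along the isomorphism of closures is equivariant for
  `absGaloisRestrict k F` (for any base `k`, any curve over `k`);
  `exists_addEquiv_geomPoints_smul_of_eq` — equal curves have equivariantly isomorphic points;
* §3 **`padicModel_exists_generator_fixed_torsion`** — (L1) in structure form for `Γ_F` on `E_F(F̄)`:
  `p` odd, `E = W/ℚ` split multiplicative at `p`, `f : Γ_F → ℤ_p` continuous with image `⊇ p^s ℤ_p`;
  then the `ker f`-fixed `p`-power torsion of `E(F̄)` consists of the multiples of ONE `Γ_F`-fixed point
  of exact order `p^k` — `E(F̄^{ker f})[p^∞] = E(F)[p^∞] ≅ ℤ/p^k`; and the pointwise form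
  `padicModel_smul_eq_self_of_fixed_of_torsion`.

HONEST FRAMING: theorems only (no definition, no named fact, no `sorry`); the hypothesis «bijective
structure map» is discharged for `K_𝔭` at a degree-one prime in the companion
`ErratumRoadFiveLocalTorsionDegreeOne.lean`. Nothing is booked; no census word, tier or label moves (T7).
References: [SerreAbelianLadic1968] Ch. I §2.1 (restriction to a decomposition group, well defined up
to conjugacy); [SilvermanATAEC1994] Thm. V.5.3; [Castella2018Erratum] Lemma 2.1, Remark (2);
[Castella2018] §2.2 («`K_𝔭 = ℚ_p`»); memo PROOF-BDP §31.2 (E), §33.12.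
-/

set_option autoImplicit false
-- the Theorems namespace of this sub repeats the summit name by design (D-0017 nested layout)
set_option linter.dupNamespace false

noncomputable section

open scoped Classical

namespace Summit.BirchSwinnertonDyer.BirchSwinnertonDyer.Theorems.TateTorsionRigidity

open Field WeierstrassCurve Literature.NumberTheory.GaloisRepresentations Literature.NumberTheory.EllipticCurves

universe u

/-! ### §1 A field with bijective structure map `k → F`: closures and absolute Galois groups agree -/

section Model

variable (k F : Type u) [Field k] [Field F] [Algebra k F]

/-- `F` is algebraic over `k` when the structure map `k → F` is onto (every element IS a scalar).
[folklore] -/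
theorem isAlgebraic_of_bijective_algebraMap (hF : Function.Bijective (algebraMap k F)) :
    Algebra.IsAlgebraic k F := by
  refine ⟨fun x => ?_⟩
  obtain ⟨y, rfl⟩ := hF.2 x
  exact isAlgebraic_algebraMap y

/-- **The chosen embedding of algebraic closures `k̄ → F̄` is a BIJECTION when `k → F` is onto**
(`F̄` is algebraic over the algebraically closed image of `k̄`). [cite: MilneFT2022, Ch. 7 (uniqueness of the algebraic closure up to isomorphism)] -/
theorem bijective_absClosureEmbedding (hF : Function.Bijective (algebraMap k F)) :
    Function.Bijective (absClosureEmbedding k F) := by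
  haveI := isAlgebraic_of_bijective_algebraMap k F hF
  letI : Algebra (AlgebraicClosure k) (AlgebraicClosure F) := (absClosureEmbedding k F).toRingHom.toAlgebra
  haveI : IsScalarTower k (AlgebraicClosure k) (AlgebraicClosure F) :=
    IsScalarTower.of_algebraMap_eq fun x => ((absClosureEmbedding k F).commutes x).symm
  haveI : Algebra.IsAlgebraic (AlgebraicClosure k) (AlgebraicClosure F) :=
    Algebra.IsAlgebraic.tower_top (K := k) (AlgebraicClosure k)
  exact IsAlgClosed.algebraMap_bijective_of_isIntegral (k := AlgebraicClosure k) (K := AlgebraicClosure F)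

/-- **`Γ_F → Γ_k` (`absGaloisRestrict`) is a BIJECTION when `k → F` is onto** (injective as `F/k` is
algebraic, onto as `k` is integrally closed in `F = k`). [cite: SerreAbelianLadic1968, Ch. I §2.1] -/
theorem bijective_absGaloisRestrict [CharZero F] (hF : Function.Bijective (algebraMap k F)) :
    Function.Bijective (absGaloisRestrict k F) := by
  haveI := isAlgebraic_of_bijective_algebraMap k F hF
  haveI : IsIntegrallyClosedIn k F :=
    isIntegrallyClosedIn_iff.mpr ⟨hF.1, fun {x} _ => hF.2 x⟩
  exact ⟨absGaloisRestrict_injective k F, absGaloisRestrict_surjective_of_isIntegrallyClosedIn k F⟩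

/-- **Every continuous homomorphism out of `Γ_F` factors CONTINUOUSLY through the bijection
`Γ_F → Γ_k`** (a continuous bijection from the compact `Γ_F` to the Hausdorff `Γ_k` is a
homeomorphism). [cite: SerreAbelianLadic1968, Ch. I §2.1] -/
theorem exists_continuousMonoidHom_comp_absGaloisRestrict [CharZero F]
    (hF : Function.Bijective (algebraMap k F)) {M : Type*} [Monoid M] [TopologicalSpace M]
    (f : absoluteGaloisGroup F →ₜ* M) :
    ∃ f' : absoluteGaloisGroup k →ₜ* M, ∀ τ : absoluteGaloisGroup F, f' (absGaloisRestrict k F τ) = f τ := by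
  have hbij := bijective_absGaloisRestrict k F hF
  let e : absoluteGaloisGroup F ≃* absoluteGaloisGroup k :=
    MulEquiv.ofBijective (absGaloisRestrict k F).toMonoidHom hbij
  have he : Continuous e.toEquiv := (absGaloisRestrict k F).continuous_toFun
  have hsymm : Continuous e.toEquiv.symm := he.continuous_symm_of_equiv_compact_to_t2
  refine ⟨{ toMonoidHom := f.toMonoidHom.comp e.symm.toMonoidHom,
            continuous_toFun := (map_continuous f).comp hsymm }, fun τ => ?_⟩
  change f (e.symm (e τ)) = f τ
  rw [MulEquiv.symm_apply_apply]

end Model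

/-! ### §2 Equivariance of the transport of points along the isomorphism of closures -/

section Points

variable {k : Type u} [Field k] (W₀ : WeierstrassCurve k) (F : Type u) [Field F] [Algebra k F]

/-- For `ι : k̄ ≃ₐ[k] F̄` with underlying map the chosen embedding, the automorphism
`ι⁻¹ ∘ σ ∘ ι` of `k̄` attached to `σ ∈ Γ_F` IS `absGaloisRestrict k F σ` (both satisfy
`ι (τ x) = σ (ι x)`). [cite: MilneFT2022, Ch. 7 (restriction to the absolute Galois group of a subfield)] -/
theorem toAlgEquiv_symm_conj_eq_absGaloisRestrict (ι : AlgebraicClosure k ≃ₐ[k] AlgebraicClosure F)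
    (hι : ∀ x, ι x = absClosureEmbedding k F x) (σ : absoluteGaloisGroup F) :
    (absoluteGaloisGroup.toAlgEquiv k).symm
        (ι.trans ((AlgEquiv.restrictScalars k
          (absoluteGaloisGroup.toAlgEquiv F σ : AlgebraicClosure F ≃ₐ[F] AlgebraicClosure F)).trans ι.symm)) =
      absGaloisRestrict k F σ := by
  apply (absoluteGaloisGroup.toAlgEquiv k).injective
  rw [MulEquiv.apply_symm_apply]
  ext x
  apply ι.injective
  change ι (ι.symm (absoluteGaloisGroup.toAlgEquiv F σ (ι x))) = ι (absGaloisRestrict k F σ • x)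
  rw [ι.apply_symm_apply, hι, hι, absGaloisRestrict_apply_smul]
  rfl

/-- **`geomPointsExtend` is `absGaloisRestrict`-equivariant**: for `ι : k̄ ≃ₐ[k] F̄` lifting the chosen
embedding, `ι_* (res σ • P) = σ • ι_* P` (`res = absGaloisRestrict k F`; the tree's
`geomPointsExtend_smul` with `toAlgEquiv_symm_conj_eq_absGaloisRestrict`). [cite: SerreGaloisCohomology1997, I.§2.4 (compatible pairs)] -/
theorem geomPointsExtend_absGaloisRestrict_smul (ι : AlgebraicClosure k ≃ₐ[k] AlgebraicClosure F)
    (hι : ∀ x, ι x = absClosureEmbedding k F x) (σ : absoluteGaloisGroup F) (P : W₀.geomPoints) :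
    W₀.geomPointsExtend F ι (absGaloisRestrict k F σ • P) = σ • W₀.geomPointsExtend F ι P := by
  rw [← toAlgEquiv_symm_conj_eq_absGaloisRestrict F ι hι σ]
  exact geomPointsExtend_smul ι σ P

omit [Algebra k F] in
/-- Equal Weierstrass curves over `F` have `Γ_F`-equivariantly isomorphic geometric points (transport
along the equality). [folklore] -/
theorem exists_addEquiv_geomPoints_smul_of_eq {W₁ W₂ : WeierstrassCurve F} (h : W₁ = W₂) :
    ∃ e : geomPoints W₁ ≃+ geomPoints W₂, ∀ (σ : absoluteGaloisGroup F) (P : geomPoints W₁),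
      e (σ • P) = σ • e P := by
  subst h
  exact ⟨AddEquiv.refl _, fun _ _ => rfl⟩

end Points

/-! ### §3 (L1) for `Γ_F` acting on `E(F̄)`, `F` a `ℚ_p`-model -/

section PadicModel

variable {p : ℕ} [Fact p.Prime]

/-- **An equivariant identification `E(ℚ̄_p) ≃ E_F(F̄)` along `Γ_F → Γ_{ℚ_p}`** for `E = W/ℚ` and a
field `F` with bijective structure map `ℚ_p → F`: `Ψ (res σ • P) = σ • Ψ P`
(`geomPointsExtend` for `W/ℚ_p` along the isomorphism of closures, then `(W/ℚ_p)/F = W/F`,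
Mathlib `map_baseChange`). [cite: Castella2018, §2.2 ("K_𝔭 = ℚ_p")] [cite: SerreGaloisCohomology1997, I.§2.4 (compatible pairs)] -/
theorem exists_addEquiv_geomPoints_padicModel (W : WeierstrassCurve ℚ) (F : Type) [Field F] [CharZero F]
    [Algebra ℚ_[p] F] (hF : Function.Bijective (algebraMap ℚ_[p] F)) :
    ∃ Ψ : geomPoints (W.baseChange ℚ_[p]) ≃+ geomPoints (W.baseChange F),
      ∀ (σ : absoluteGaloisGroup F) (P : geomPoints (W.baseChange ℚ_[p])),
        Ψ (absGaloisRestrict ℚ_[p] F σ • P) = σ • Ψ P := by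
  let ι : AlgebraicClosure ℚ_[p] ≃ₐ[ℚ_[p]] AlgebraicClosure F :=
    AlgEquiv.ofBijective (absClosureEmbedding ℚ_[p] F) (bijective_absClosureEmbedding ℚ_[p] F hF)
  have hι : ∀ x, ι x = absClosureEmbedding ℚ_[p] F x := fun _ => rfl
  have hW : (W.baseChange ℚ_[p]).baseChange F = W.baseChange F :=
    W.map_baseChange (algebraMap ℚ_[p] F).toRatAlgHom
  obtain ⟨e, he⟩ := exists_addEquiv_geomPoints_smul_of_eq F hW
  refine ⟨((W.baseChange ℚ_[p]).geomPointsExtend F ι).trans e, fun σ P => ?_⟩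
  rw [AddEquiv.trans_apply, AddEquiv.trans_apply,
    geomPointsExtend_absGaloisRestrict_smul (W.baseChange ℚ_[p]) F ι hι σ P, he]

/-- **(L1) FOR `Γ_F` ON `E(F̄)`, `F` a `ℚ_p`-model, structure form.** `p` odd, `E = W/ℚ` with SPLIT
multiplicative reduction at `p`, `F` a field with bijective structure map `ℚ_p → F` (`K_𝔭` at a
degree-one `𝔭 ∣ p`), `f : Γ_F → ℤ_p` continuous with image `⊇ p^s ℤ_p` (the anticyclotomic character
on the decomposition group at `𝔭`): there are `k : ℕ` and ONE `Γ_F`-fixed `P₀ ∈ E(F̄)` of exact order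
`p^k` such that every `ker f`-fixed `p`-power-torsion point of `E(F̄)` is an integer multiple of `P₀` —
**`E(F̄^{ker f})[p^∞] = E(F)[p^∞] ≅ ℤ/p^k`**. Transport of p486449's
`openImage_curve_exists_generator_fixed_torsion` along `exists_addEquiv_geomPoints_padicModel`, the
character `f` being pushed to `Γ_{ℚ_p}` by `exists_continuousMonoidHom_comp_absGaloisRestrict`.
[cite: SilvermanATAEC1994, Thm. V.5.3 (PDF pp. 407–409)] [cite: Castella2018Erratum, Lemma 2.1 and Remark (2) (p. 2)] -/
theorem padicModel_exists_generator_fixed_torsion (hp2 : p ≠ 2) (W : WeierstrassCurve ℚ) [W.IsElliptic]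
    (hsplit : W.HasSplitMultiplicativeReductionAtPrime p) (F : Type) [Field F] [CharZero F]
    [Algebra ℚ_[p] F] (hF : Function.Bijective (algebraMap ℚ_[p] F))
    (f : absoluteGaloisGroup F →ₜ* Multiplicative ℤ_[p]) {s : ℕ}
    (hsurj : ∀ y : ℤ_[p], ∃ σ : absoluteGaloisGroup F, (f σ).toAdd = (p : ℤ_[p]) ^ s * y) :
    ∃ (k : ℕ) (P₀ : geomPoints (W.baseChange F)),
      (∀ σ : absoluteGaloisGroup F, σ • P₀ = P₀) ∧ (p ^ k) • P₀ = 0 ∧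
      (∀ j : ℕ, j • P₀ = 0 → p ^ k ∣ j) ∧
      ∀ (P : geomPoints (W.baseChange F)) (n : ℕ), (p ^ n) • P = 0 →
        (∀ τ ∈ f.toMonoidHom.ker, τ • P = P) → ∃ j : ℤ, P = j • P₀ := by
  have hbij := bijective_absGaloisRestrict ℚ_[p] F hF
  obtain ⟨f', hf'⟩ := exists_continuousMonoidHom_comp_absGaloisRestrict ℚ_[p] F hF f
  obtain ⟨Ψ, hΨ⟩ := exists_addEquiv_geomPoints_padicModel W F hF
  -- the pushed character has image `⊇ p^s ℤ_p`
  have hsurj' : ∀ y : ℤ_[p], ∃ σ : absoluteGaloisGroup ℚ_[p], (f' σ).toAdd = (p : ℤ_[p]) ^ s * y := by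
    intro y
    obtain ⟨σ, hσ⟩ := hsurj y
    exact ⟨absGaloisRestrict ℚ_[p] F σ, by rw [hf', hσ]⟩
  obtain ⟨k, Q₀, hG, hk, hord, hgen⟩ :=
    openImage_curve_exists_generator_fixed_torsion hp2 f' hsurj' W hsplit
  refine ⟨k, Ψ Q₀, fun σ => ?_, ?_, fun j hj => ?_, fun P n hP hfix => ?_⟩
  · rw [← hΨ, hG]
  · rw [← map_nsmul, hk, map_zero]
  · exact hord j (Ψ.injective (by rw [map_nsmul, hj, map_zero]))
  · -- pull `P` back to `E(ℚ̄_p)`; it is `ker f'`-fixed since `ker f' = res (ker f)`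
    have hfix' : ∀ τ' ∈ f'.toMonoidHom.ker, τ' • Ψ.symm P = Ψ.symm P := by
      intro τ' hτ'
      obtain ⟨τ, rfl⟩ := hbij.2 τ'
      have hτ : τ ∈ f.toMonoidHom.ker := by
        rw [MonoidHom.mem_ker] at hτ' ⊢
        change f τ = 1
        rw [← hf']; exact hτ'
      apply Ψ.injective
      rw [hΨ, AddEquiv.apply_symm_apply, hfix τ hτ]
    obtain ⟨j, hj⟩ := hgen (Ψ.symm P) n (by rw [← map_nsmul, hP, map_zero]) hfix'
    refine ⟨j, ?_⟩
    rw [← Ψ.apply_symm_apply P, hj, map_zsmul]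

/-- **(L1) FOR `Γ_F` ON `E(F̄)`, pointwise form**: under the same hypotheses every `ker f`-fixed
`p`-power-torsion point of `E(F̄)` is `Γ_F`-fixed and killed by the `p^k` of
`padicModel_exists_generator_fixed_torsion` — «no new `p`-power torsion in `F̄^{ker f} = K_{∞,w}`».
[cite: SilvermanATAEC1994, Thm. V.5.3 (PDF pp. 407–409)] [cite: Castella2018Erratum, Lemma 2.1 and Remark (2) (p. 2)] -/
theorem padicModel_smul_eq_self_of_fixed_of_torsion (hp2 : p ≠ 2) (W : WeierstrassCurve ℚ) [W.IsElliptic]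
    (hsplit : W.HasSplitMultiplicativeReductionAtPrime p) (F : Type) [Field F] [CharZero F]
    [Algebra ℚ_[p] F] (hF : Function.Bijective (algebraMap ℚ_[p] F))
    (f : absoluteGaloisGroup F →ₜ* Multiplicative ℤ_[p]) {s : ℕ}
    (hsurj : ∀ y : ℤ_[p], ∃ σ : absoluteGaloisGroup F, (f σ).toAdd = (p : ℤ_[p]) ^ s * y)
    (P : geomPoints (W.baseChange F)) {n : ℕ} (hP : (p ^ n) • P = 0)
    (hfix : ∀ τ ∈ f.toMonoidHom.ker, τ • P = P) (σ : absoluteGaloisGroup F) : σ • P = P := by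
  obtain ⟨k, P₀, hG, -, -, hgen⟩ := padicModel_exists_generator_fixed_torsion hp2 W hsplit F hF f hsurj
  obtain ⟨j, rfl⟩ := hgen P n hP hfix
  have h := map_zsmul (DistribSMul.toAddMonoidHom (geomPoints (W.baseChange F)) σ) j P₀
  simp only [DistribSMul.toAddMonoidHom_apply] at h
  rw [h, hG]

end PadicModel

end Summit.BirchSwinnertonDyer.BirchSwinnertonDyer.Theorems.TateTorsionRigidity

end
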